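import Mathlib
import HarnessLib

/-!
# Fouvry–Tenenbaum 2021, Theorems 1.5 and 1.8, for the Liouville function

Topic `Literature/NumberTheory/Sieve`; namespace `Literature.NumberTheory.Sieve`.

É. Fouvry, G. Tenenbaum, *Multiplicative functions in large arithmetic progressions and
applications*, Trans. Amer. Math. Soc. 375 (2021/22), 245–299, doi:10.1090/tran/8442
[FouvryTenenbaum2021].  Two NAMED FACTS (D-0014: `def … : Prop`, users take `(h : …)`), vendoring
the paper's central mean-value theorems SPECIALISED to the Liouville function `f = λ`:

* `FouvryTenenbaum2021_thm15_liouville` — Theorem 1.5 (PDF p. 8, §1.3 "The central results"): the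
  Bombieri–Friedlander–Iwaniec "Theorem 9" shape (absolute values outside the `q`-sum only, moduli
  `qr`, fixed residue `a`, `1 ≤ |a| ≤ ℒ^A`) at LEVEL `QR ≤ x/ℒ^B` with `R ≤ x^{1/105−ε}`;
* `FouvryTenenbaum2021_thm18_liouville` — Theorem 1.8 (PDF p. 9, §1.4; "a variant of a result of
  Wolke [28, Satz 1]"): the Bombieri–Vinogradov shape `∑_{q ≤ Q} max_{(a,q)=1} |Δ_λ(x; q, a)|`,
  `Q ≤ √x/ℒ^B`.

Both printed theorems are UNIFORM over `D ≥ 1` and `f ∈ 𝓕(D, K)` (Definition 1.1, PDF p. 6: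
multiplicative `f` with (i) a sequence `2 = Υ₁ < Υ₂ < ⋯`, `Υ_{n+1}/Υ_n ≥ 1 + (log 2Υ_n)^{−K}`,
(ii) `f(p) = f(p')` for primes `Υ_n < p, p' ≤ Υ_{n+1}` with `p ≡ p' (mod D)`, (iii) `|f(n)| ≤ τ_K(n)`),
with the bound `C D^{C₀} x/ℒ^A`, `ℒ := log 3x` (Conventions §1.1, PDF p. 5).  The Liouville function
has `λ(p) = −1` for every prime and `|λ| = 1 = τ_1`, so `λ ∈ 𝓕(1, 1)` for ANY admissible sequence
`Υ`; at `D = 1` the generalised discrepancy `Δ_f(x; q, D, a)` of (1.15) is the plain one of (1.1)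
((1.16), PDF p. 7: "When `(q, D) = 1`, we have `Δ_f(x; q, D, a) = Δ_f(x; q, a)`"), and `D^{C₀} = 1`.
Hence the two defs below are the printed theorems instantiated at `D = 1`, `K = 1`, `f = λ`, with the
printed quantifier structure ("for suitable B = B(A, ε, K), C = C(A, ε, K) … uniformly for x ≥ 1,
R ≤ x^{1/105−ε}, QR ≤ x/ℒ^B, 1 ≤ |a| ≤ ℒ^A") made explicit as `∃ B C, ∀ x ≥ 1, …`.

Requested by / grounds: the crux `Summit.Parity.GeneralizedHardyLittlewood.Theses.LiouvilleShiftedTables.TypeI2Dilated`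
(stmt-Parity-14272; its `q = 1` slice is Theorem 1.5 with `f = λ` after removing coprimality
conditions and the `φ(qr)⁻¹ ∑_{(n,qr)=1} λ(n)` main terms by the prime number theorem for `λ`) and the
support `…LiouvilleShiftedTables.BVLiouville` (stmt-Parity-13324; Theorem 1.8 with `f = λ`).
The general-`f` statements are NOT vendored here (the class `𝓕(D, K)` would need the block sequence
`Υ` as data); `Mathlib` has no level-of-distribution notion, cf.
`Literature.NumberTheory.Sieve.LevelOfDistribution` and the in-tree BFI Theorem 9
`Literature.NumberTheory.Sieve.BombieriFriedlanderIwaniecTheorem9` (same `∑_r |∑_q ⋯|` rendering,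
`IsCoprime (r : ℤ) a`, ranges `Icc 1 ⌊R⌋₊`).

## Design / junk values

* `liouvilleAPDelta x d a` is FT's `Δ_λ(x; d, a)` of (1.1): `∑_{n ≤ x, n ≡ a (mod d)} λ(n) −
  φ(d)⁻¹ ∑_{n ≤ x, (n,d)=1} λ(n)`, with `n` ranging over `Icc 1 ⌊x⌋₊` (so `x < 1` gives `0`), the
  congruence read in `ℤ` (`Int.ModEq d n a`) and `λ = ArithmeticFunction.liouville` cast to `ℝ`;
  `φ(d)⁻¹ = 0` at `d = 0` (never used: `d = qr ≥ 1`).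
* `ℒ = Real.log (3 * x) > 1` for `x ≥ 1`, so `x/ℒ^B` carries no division junk.
* `Q`, `R` are real (as printed); `Q < 1` or `R < 1` make the sums empty (`⌊·⌋₊ = 0`), and then the
  conclusion `0 ≤ C x/ℒ^A` is part of the content (it forces `C ≥ 0`, harmless and true in print).
* Theorem 1.8's `max_{(a, q) = 1}` is rendered by quantifying over a residue selector
  `a : ℕ → ℤ` with `IsCoprime (a q) q` for every `q` — equivalent to the printed `max` (choose a
  maximiser per modulus), the form the route items consume.
-/

noncomputable section

open Finset

namespace Literature.NumberTheory.Sieve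

/-- `Δ_λ(x; d, a) = ∑_{n ≤ x, n ≡ a (mod d)} λ(n) − φ(d)⁻¹ ∑_{n ≤ x, (n, d) = 1} λ(n)` — the
discrepancy (1.1) of Fouvry–Tenenbaum for the Liouville function.
[cite: FouvryTenenbaum2021, (1.1)] -/
def liouvilleAPDelta (x : ℝ) (d : ℕ) (a : ℤ) : ℝ :=
  (∑ n ∈ (Icc 1 ⌊x⌋₊).filter (fun n : ℕ => Int.ModEq d n a),
      (ArithmeticFunction.liouville n : ℝ)) -
    ((Nat.totient d : ℝ))⁻¹ *
      ∑ n ∈ (Icc 1 ⌊x⌋₊).filter (fun n : ℕ => Nat.Coprime n d),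
        (ArithmeticFunction.liouville n : ℝ)

/-- NAMED FACT — **Fouvry–Tenenbaum 2021, Theorem 1.5, for `f = λ`** (PDF p. 8): "The following
statement holds for suitable, absolute `C₀`. Let `A > 0`, `ε > 0`, `K > 0`. There exist
`B = B(A, ε, K)` and `C = C(A, ε, K)` such that, uniformly for `D ≥ 1`, `f ∈ 𝓕(D, K)`, `x ≥ 1`,
`R ≤ x^{1/105−ε}`, `QR ≤ x/ℒ^B`, `(a, D) = 1`, `1 ≤ |a| ≤ ℒ^A`, we have
`∑_{r ≤ R, (r,a)=1} |∑_{q ≤ Q, (q,a)=1} Δ_f(x; qr, D, a)| ≤ C D^{C₀} x/ℒ^A`" (`ℒ = log 3x`),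
instantiated at `D = 1`, `K = 1`, `f = λ ∈ 𝓕(1, 1)` (Definition 1.1: `λ(p) = −1` on all primes,
`|λ| = τ_1 = 1`), where `Δ_f(x; q, 1, a) = Δ_f(x; q, a)` ((1.16)).  The `∑_r |∑_q ⋯|` placement is that
of BFI 1986 Theorem 9 (the paper's Theorem B), of which this is the multiplicative-function analogue.
Users take `(h : FouvryTenenbaum2021_thm15_liouville)`; grounds the `q = 1` slice of
`Summit.Parity.GeneralizedHardyLittlewood.Theses.LiouvilleShiftedTables.TypeI2Dilated`.
[cite: FouvryTenenbaum2021, Thm 1.5] -/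
def FouvryTenenbaum2021_thm15_liouville : Prop :=
  ∀ A : ℝ, 0 < A → ∀ ε : ℝ, 0 < ε → ∃ B C : ℝ, ∀ x : ℝ, 1 ≤ x → ∀ Q R : ℝ,
    R ≤ x ^ (1 / 105 - ε) → Q * R ≤ x / Real.log (3 * x) ^ B →
    ∀ a : ℤ, 1 ≤ |a| → (|a| : ℝ) ≤ Real.log (3 * x) ^ A →
      ∑ r ∈ (Icc 1 ⌊R⌋₊).filter (fun r : ℕ => IsCoprime (r : ℤ) a),
          |∑ q ∈ (Icc 1 ⌊Q⌋₊).filter (fun q : ℕ => IsCoprime (q : ℤ) a),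
              liouvilleAPDelta x (q * r) a| ≤
        C * x / Real.log (3 * x) ^ A

/-- NAMED FACT — **Fouvry–Tenenbaum 2021, Theorem 1.8, for `f = λ`** (PDF p. 9, §1.4: "which may be
seen as a variant of a result of Wolke [28, Satz 1]"): "The following statement holds for suitable,
absolute `C₀`. Let `A > 0`, `K > 0`. There exist `B = B(A, K)` and `C = C(A, K)` such that,
uniformly for `D ≥ 1`, `f ∈ 𝓕(D, K)`, `x ≥ 1`, `Q ≤ √x/ℒ^B`, we have
`∑_{q ≤ Q} max_{(a, qD)=1} |Δ_f(x; q, D, a)| ≤ C D^{C₀} x/ℒ^A`" (`ℒ = log 3x`), instantiated at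
`D = 1`, `K = 1`, `f = λ`; the `max` over reduced residues is rendered by an arbitrary selector
`a q` coprime to `q` (Bombieri–Vinogradov for the Liouville function at level `x^{1/2}ℒ^{−B}`).
Users take `(h : FouvryTenenbaum2021_thm18_liouville)`; grounds
`Summit.Parity.GeneralizedHardyLittlewood.Theses.LiouvilleShiftedTables.BVLiouville`.
[cite: FouvryTenenbaum2021, Thm 1.8] -/
def FouvryTenenbaum2021_thm18_liouville : Prop :=
  ∀ A : ℝ, 0 < A → ∃ B C : ℝ, ∀ x : ℝ, 1 ≤ x → ∀ Q : ℝ,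
    Q ≤ x ^ (1 / 2 : ℝ) / Real.log (3 * x) ^ B →
    ∀ a : ℕ → ℤ, (∀ q : ℕ, IsCoprime (a q) q) →
      ∑ q ∈ Icc 1 ⌊Q⌋₊, |liouvilleAPDelta x q (a q)| ≤ C * x / Real.log (3 * x) ^ A

/-- Sanity: with empty ranges (`R < 1`) the left side of Theorem 1.5 vanishes. [folklore] -/
theorem FouvryTenenbaum2021_thm15_liouville_lhs_of_lt_one (x Q R : ℝ) (hR : R < 1) (a : ℤ) :
    ∑ r ∈ (Icc 1 ⌊R⌋₊).filter (fun r : ℕ => IsCoprime (r : ℤ) a),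
        |∑ q ∈ (Icc 1 ⌊Q⌋₊).filter (fun q : ℕ => IsCoprime (q : ℤ) a),
            liouvilleAPDelta x (q * r) a| = 0 := by
  have h : ⌊R⌋₊ = 0 := Nat.floor_eq_zero.mpr hR
  simp [h]

/-!
## Proved reductions towards `FouvryTenenbaum2021_thm15_liouville_holds` (appended 2026-08-15)

Everything below is PROVED; no definition and no named fact is added.

**Status of the discharge.**  Theorem 1.5 is proved in §§5–7 of the source from four deep inputs
that neither Mathlib nor the tree has: Lemma 4.7 (a form of Bombieri–Friedlander–Iwaniec 1986,
Theorem 6, UNIFORM in `1 ≤ |a| ≤ (log X)^A` — Linnik's dispersion method and the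
Deshouillers–Iwaniec bounds; the tree's `BombieriFriedlanderIwaniecTheorem6` is the fixed-`a`
statement and is itself an unproved fact), Lemma 4.8 (Fouvry–Radziwiłł, unbalanced convolutions),
Lemma 4.12 (`τ₂` in progressions to level `x^{2/3−ε}`, Weil's bound) and Lemma 4.13 (Heath-Brown's
`d₃` theorem, level `x^{21/41−ε}`, Deligne's bounds), besides the Selberg–Delange main-term
lemmas 4.14–4.15 of §7.  The section below starts the bottom-up formalisation with the standing
reductions every later step uses.

**Contents.**
* `FouvryTenenbaum.abs_sum_liouville_filter_le`, `….inv_totient_le_one`,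
  `….one_lt_log_three_mul` — a `λ`-sum over part of `[1, x]` is `≤ x` (`|λ| ≤ 1`), `φ(d)⁻¹ ≤ 1`,
  `ℒ = log 3x > 1`.
* `liouvilleAPDelta_one` (`Δ_λ(x; 1, a) = 0`), `abs_liouvilleAPDelta_le` (`|Δ_λ(x; d, a)| ≤ 2x`),
  `liouvilleAPDelta_of_lt_one`, `FouvryTenenbaum.thm15_lhs_le` (trivial bound `⌊R⌋⌊Q⌋·2x` for the
  left side of (1.18)), `FouvryTenenbaum.thm15_lhs_of_Q_lt_one`.
* `FouvryTenenbaum.sum_mul_sum_eq_sum_divisorWeight`, `FouvryTenenbaum.abs_divisorWeight_le` — the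
  regrouping (5.5) along `s = qr` with `c_s = ∑_{qr = s} ξ_r`, `|c_s| ≤ τ(s)`;
  `liouvilleAPDelta_sub_of_le`, `liouvilleAPDelta_eq_sum_dyadic` — the differencing / dyadic
  decomposition in `x` of (5.4).
* `FouvryTenenbaum2021_thm15_liouville.of_eventually` — **reduction to large `x` and `Q, R ≥ 1`**
  (§1.1, PDF p. 5: "In some instances it will be implicitly assumed that `x` is sufficiently
  large"): constants `B, C, x₀` valid for `x ≥ x₀` give constants valid for `x ≥ 1`, the range
  `1 ≤ x < x₀` being absorbed because the left side is `≤ 2x²` there.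
* `FouvryTenenbaum2021_thm15_liouville.of_signed`, `….signed_le` — **the signed form** (§5.1,
  (5.4)–(5.5): the absolute values over `r` become weights "`ξ_r` … satisfying `|ξ_r| ≤ 1`").
-/

open Real

namespace FouvryTenenbaum

/-! ### Elementary bounds -/

/-- A sum of `λ(n)` over any part of `1 ≤ n ≤ x` is at most `x` in absolute value (`x ≥ 0`), since
`|λ(n)| ≤ 1` (the tree's `Literature.NumberTheory.Sieve.abs_liouville_le_one`, re-proved inline to
keep this file's imports minimal). [folklore] -/
theorem abs_sum_liouville_filter_le {x : ℝ} (hx : 0 ≤ x) (p : ℕ → Prop) [DecidablePred p] :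
    |∑ n ∈ (Icc 1 ⌊x⌋₊).filter p, (ArithmeticFunction.liouville n : ℝ)| ≤ x := by
  have hlam : ∀ n : ℕ, |(ArithmeticFunction.liouville n : ℝ)| ≤ 1 := fun n => by
    rcases eq_or_ne n 0 with rfl | hn
    · simp
    · rw [ArithmeticFunction.liouville_apply hn]
      push_cast
      rw [abs_pow, abs_neg, abs_one, one_pow]
  calc |∑ n ∈ (Icc 1 ⌊x⌋₊).filter p, (ArithmeticFunction.liouville n : ℝ)|
        ≤ ∑ n ∈ (Icc 1 ⌊x⌋₊).filter p, |(ArithmeticFunction.liouville n : ℝ)| :=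
          abs_sum_le_sum_abs _ _
    _ ≤ ∑ _n ∈ (Icc 1 ⌊x⌋₊).filter p, (1 : ℝ) :=
          sum_le_sum fun n _ => hlam n
    _ = (((Icc 1 ⌊x⌋₊).filter p).card : ℝ) := by rw [sum_const, nsmul_eq_mul, mul_one]
    _ ≤ ((Icc 1 ⌊x⌋₊).card : ℝ) := by exact_mod_cast card_filter_le _ _
    _ = ⌊x⌋₊ := by rw [Nat.card_Icc, Nat.add_sub_cancel]
    _ ≤ x := Nat.floor_le hx

/-- `φ(d)⁻¹ ≤ 1` in `ℝ` (at `d = 0`, `φ(0)⁻¹ = 0⁻¹ = 0`). [folklore] -/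
theorem inv_totient_le_one (d : ℕ) : ((Nat.totient d : ℝ))⁻¹ ≤ 1 := by
  rcases eq_or_ne d 0 with rfl | hd
  · simp
  · have h1 : (1 : ℝ) ≤ (Nat.totient d : ℝ) := by
      exact_mod_cast Nat.totient_pos.mpr (Nat.pos_of_ne_zero hd)
    exact inv_le_one_of_one_le₀ h1

/-- `1 < ℒ = log 3x` for `x ≥ 1` (since `e < 3`). [folklore] -/
theorem one_lt_log_three_mul {x : ℝ} (hx : 1 ≤ x) : 1 < Real.log (3 * x) := by
  rw [Real.lt_log_iff_exp_lt (by positivity)]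
  have := Real.exp_one_lt_d9
  linarith

end FouvryTenenbaum

open FouvryTenenbaum

/-! ### API for `liouvilleAPDelta` -/

/-- `Δ_λ(x; 1, a) = 0`: to the modulus `1` every `n` is `≡ a` and coprime, and `φ(1) = 1`.
[cite: FouvryTenenbaum2021, (1.1)] -/
theorem liouvilleAPDelta_one (x : ℝ) (a : ℤ) : liouvilleAPDelta x 1 a = 0 := by
  unfold liouvilleAPDelta
  have h1 : (Icc 1 ⌊x⌋₊).filter (fun n : ℕ => Int.ModEq ((1 : ℕ) : ℤ) n a) = Icc 1 ⌊x⌋₊ :=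
    filter_true_of_mem fun n _ => by
      rw [Nat.cast_one]
      exact Int.modEq_one
  have h2 : (Icc 1 ⌊x⌋₊).filter (fun n : ℕ => Nat.Coprime n 1) = Icc 1 ⌊x⌋₊ :=
    filter_true_of_mem fun n _ => Nat.coprime_one_right n
  rw [h1, h2, Nat.totient_one, Nat.cast_one, inv_one, one_mul, sub_self]

/-- **Trivial bound** `|Δ_λ(x; d, a)| ≤ 2x` (`x ≥ 0`): each of the two `λ`-sums in (1.1) has at most
`x` terms of modulus `≤ 1`, and `φ(d)⁻¹ ≤ 1`. [cite: FouvryTenenbaum2021, (1.1)] -/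
theorem abs_liouvilleAPDelta_le {x : ℝ} (hx : 0 ≤ x) (d : ℕ) (a : ℤ) :
    |liouvilleAPDelta x d a| ≤ 2 * x := by
  unfold liouvilleAPDelta
  have h1 := abs_sum_liouville_filter_le hx (fun n : ℕ => Int.ModEq (d : ℤ) n a)
  have h2 := abs_sum_liouville_filter_le hx (fun n : ℕ => Nat.Coprime n d)
  have h3 : |((Nat.totient d : ℝ))⁻¹ *
      ∑ n ∈ (Icc 1 ⌊x⌋₊).filter (fun n : ℕ => Nat.Coprime n d),
        (ArithmeticFunction.liouville n : ℝ)| ≤ x := by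
    rw [abs_mul, abs_of_nonneg (inv_nonneg.mpr (Nat.cast_nonneg _))]
    calc _ ≤ 1 * x := mul_le_mul (inv_totient_le_one d) h2 (abs_nonneg _) zero_le_one
      _ = x := one_mul x
  calc _ ≤ _ := abs_sub _ _
    _ ≤ x + x := add_le_add h1 h3
    _ = 2 * x := by ring

namespace FouvryTenenbaum

/-- **Trivial bound for the left side of Theorem 1.5**:
`∑_{r ≤ R, (r,a)=1} |∑_{q ≤ Q, (q,a)=1} Δ_λ(x; qr, a)| ≤ ⌊R⌋ · ⌊Q⌋ · 2x` (`x ≥ 0`). [folklore] -/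
theorem thm15_lhs_le {x : ℝ} (hx : 0 ≤ x) (Q R : ℝ) (a : ℤ) :
    ∑ r ∈ (Icc 1 ⌊R⌋₊).filter (fun r : ℕ => IsCoprime (r : ℤ) a),
        |∑ q ∈ (Icc 1 ⌊Q⌋₊).filter (fun q : ℕ => IsCoprime (q : ℤ) a),
            liouvilleAPDelta x (q * r) a| ≤ ⌊R⌋₊ * (⌊Q⌋₊ * (2 * x)) := by
  have hq : ∀ r : ℕ, |∑ q ∈ (Icc 1 ⌊Q⌋₊).filter (fun q : ℕ => IsCoprime (q : ℤ) a),
      liouvilleAPDelta x (q * r) a| ≤ ⌊Q⌋₊ * (2 * x) := fun r => by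
    calc _ ≤ ∑ q ∈ (Icc 1 ⌊Q⌋₊).filter (fun q : ℕ => IsCoprime (q : ℤ) a),
          |liouvilleAPDelta x (q * r) a| := abs_sum_le_sum_abs _ _
      _ ≤ ∑ _q ∈ (Icc 1 ⌊Q⌋₊).filter (fun q : ℕ => IsCoprime (q : ℤ) a), 2 * x :=
          sum_le_sum fun q _ => abs_liouvilleAPDelta_le hx _ _
      _ = (((Icc 1 ⌊Q⌋₊).filter (fun q : ℕ => IsCoprime (q : ℤ) a)).card : ℝ) * (2 * x) := by
          rw [sum_const, nsmul_eq_mul]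
      _ ≤ ⌊Q⌋₊ * (2 * x) := by
          refine mul_le_mul_of_nonneg_right ?_ (by positivity)
          calc (((Icc 1 ⌊Q⌋₊).filter (fun q : ℕ => IsCoprime (q : ℤ) a)).card : ℝ)
              ≤ ((Icc 1 ⌊Q⌋₊).card : ℝ) := by exact_mod_cast card_filter_le _ _
            _ = ⌊Q⌋₊ := by rw [Nat.card_Icc, Nat.add_sub_cancel]
  calc _ ≤ ∑ _r ∈ (Icc 1 ⌊R⌋₊).filter (fun r : ℕ => IsCoprime (r : ℤ) a), (⌊Q⌋₊ * (2 * x) : ℝ) :=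
        sum_le_sum fun r _ => hq r
    _ = (((Icc 1 ⌊R⌋₊).filter (fun r : ℕ => IsCoprime (r : ℤ) a)).card : ℝ) * (⌊Q⌋₊ * (2 * x)) := by
        rw [sum_const, nsmul_eq_mul]
    _ ≤ ⌊R⌋₊ * (⌊Q⌋₊ * (2 * x)) := by
        refine mul_le_mul_of_nonneg_right ?_ (by positivity)
        calc (((Icc 1 ⌊R⌋₊).filter (fun r : ℕ => IsCoprime (r : ℤ) a)).card : ℝ)
            ≤ ((Icc 1 ⌊R⌋₊).card : ℝ) := by exact_mod_cast card_filter_le _ _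
          _ = ⌊R⌋₊ := by rw [Nat.card_Icc, Nat.add_sub_cancel]

/-- With `Q < 1` the `q`-ranges are empty and the left side of Theorem 1.5 vanishes. [folklore] -/
theorem thm15_lhs_of_Q_lt_one (x Q R : ℝ) (hQ : Q < 1) (a : ℤ) :
    ∑ r ∈ (Icc 1 ⌊R⌋₊).filter (fun r : ℕ => IsCoprime (r : ℤ) a),
        |∑ q ∈ (Icc 1 ⌊Q⌋₊).filter (fun q : ℕ => IsCoprime (q : ℤ) a),
            liouvilleAPDelta x (q * r) a| = 0 := by
  have h : ⌊Q⌋₊ = 0 := Nat.floor_eq_zero.mpr hQ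
  simp [h]

end FouvryTenenbaum

/-! ### The regrouping along `s = qr` and the dyadic decomposition (§5.1, (5.4)–(5.5)) -/

namespace FouvryTenenbaum

/-- **Regrouping along `s = qr`** ((5.5), PDF p. 22: "`S := QR` and `c_s := ∑_{r ≤ R, q ≤ Q, s = qr} ξ_r`"):
for real weights `ξ` and any `F`,
`∑_{r ≤ R, (r,a)=1} ξ_r ∑_{q ≤ Q, (q,a)=1} F(qr) = ∑_{s ≤ QR, (s,a)=1} c_s F(s)` with
`c_s = ∑_{r ∣ s, r ≤ R, s/r ≤ Q} ξ_r` (here `Q, R` are natural numbers — apply with `⌊Q⌋₊, ⌊R⌋₊`;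
`(qr, a) = 1 ⇔ (q, a) = (r, a) = 1`). [cite: FouvryTenenbaum2021, §5.1 (5.5)] -/
theorem sum_mul_sum_eq_sum_divisorWeight (ξ F : ℕ → ℝ) (Q R : ℕ) (a : ℤ) :
    ∑ r ∈ (Icc 1 R).filter (fun r : ℕ => IsCoprime (r : ℤ) a),
        ξ r * ∑ q ∈ (Icc 1 Q).filter (fun q : ℕ => IsCoprime (q : ℤ) a), F (q * r) =
      ∑ s ∈ (Icc 1 (Q * R)).filter (fun s : ℕ => IsCoprime (s : ℤ) a),
        (∑ r ∈ s.divisors.filter (fun r : ℕ => r ≤ R ∧ s / r ≤ Q), ξ r) * F s := by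
  simp_rw [Finset.mul_sum, Finset.sum_mul]
  rw [← Finset.sum_product', Finset.sum_sigma']
  refine Finset.sum_bij' (fun p _ => ⟨p.2 * p.1, p.1⟩) (fun p _ => (p.2, p.1 / p.2)) ?_ ?_ ?_ ?_ ?_
  · rintro ⟨r, q⟩ hp
    simp only [mem_product, mem_filter, mem_Icc] at hp
    obtain ⟨⟨⟨hr1, hrR⟩, hra⟩, ⟨hq1, hqQ⟩, hqa⟩ := hp
    have hr0 : 0 < r := hr1
    simp only [mem_sigma, mem_filter, mem_Icc, Nat.mem_divisors]
    refine ⟨⟨⟨Nat.one_le_iff_ne_zero.mpr (Nat.mul_ne_zero (by omega) (by omega)),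
      Nat.mul_le_mul hqQ hrR⟩, ?_⟩, ⟨Dvd.intro_left q rfl, Nat.mul_ne_zero (by omega) (by omega)⟩,
      hrR, by rwa [Nat.mul_div_cancel _ hr0]⟩
    push_cast
    exact IsCoprime.mul_left hqa hra
  · rintro ⟨s, r⟩ hp
    simp only [mem_sigma, mem_filter, mem_Icc, Nat.mem_divisors] at hp
    obtain ⟨⟨⟨hs1, hsQR⟩, hsa⟩, ⟨hrs, hs0⟩, hrR, hsrQ⟩ := hp
    have hr0 : 0 < r := Nat.pos_of_dvd_of_pos hrs hs1
    obtain ⟨k, rfl⟩ := hrs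
    have hk0 : 0 < k := by
      rcases Nat.eq_zero_or_pos k with hk | hk
      · subst hk; simp at hs1
      · exact hk
    simp only [mem_product, mem_filter, mem_Icc]
    rw [Nat.mul_div_cancel_left _ hr0] at hsrQ ⊢
    push_cast at hsa
    exact ⟨⟨⟨hr0, hrR⟩, hsa.of_mul_left_left⟩, ⟨hk0, hsrQ⟩, hsa.of_mul_left_right⟩
  · rintro ⟨r, q⟩ hp
    simp only [mem_product, mem_filter, mem_Icc] at hp
    have hr0 : 0 < r := hp.1.1.1
    simp [Nat.mul_div_cancel _ hr0]
  · rintro ⟨s, r⟩ hp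
    simp only [mem_sigma, mem_filter, mem_Icc, Nat.mem_divisors] at hp
    obtain ⟨-, ⟨hrs, -⟩, -, -⟩ := hp
    simp [Nat.div_mul_cancel hrs]
  · rintro ⟨r, q⟩ _
    rfl

/-- `|c_s| ≤ τ(s)` for weights `|ξ_r| ≤ 1` ((5.5), PDF p. 22: "Note the bounds `S ≪ x^{53/105}` and
`|c_s| ≤ τ(s)`"). [cite: FouvryTenenbaum2021, §5.1 (5.5)] -/
theorem abs_divisorWeight_le {ξ : ℕ → ℝ} (hξ : ∀ r, |ξ r| ≤ 1) (Q R s : ℕ) :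
    |∑ r ∈ s.divisors.filter (fun r : ℕ => r ≤ R ∧ s / r ≤ Q), ξ r| ≤ s.divisors.card := by
  calc _ ≤ ∑ r ∈ s.divisors.filter (fun r : ℕ => r ≤ R ∧ s / r ≤ Q), |ξ r| := abs_sum_le_sum_abs _ _
    _ ≤ ∑ _r ∈ s.divisors.filter (fun r : ℕ => r ≤ R ∧ s / r ≤ Q), (1 : ℝ) :=
        sum_le_sum fun r _ => hξ r
    _ = ((s.divisors.filter (fun r : ℕ => r ≤ R ∧ s / r ≤ Q)).card : ℝ) := by simp
    _ ≤ s.divisors.card := by exact_mod_cast card_filter_le _ _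

end FouvryTenenbaum

/-- `Δ_λ(x; d, a) = 0` for `x < 1` (empty ranges). [cite: FouvryTenenbaum2021, (1.1)] -/
theorem liouvilleAPDelta_of_lt_one {x : ℝ} (hx : x < 1) (d : ℕ) (a : ℤ) :
    liouvilleAPDelta x d a = 0 := by
  have h : ⌊x⌋₊ = 0 := Nat.floor_eq_zero.mpr hx
  simp [liouvilleAPDelta, h]

/-- **Differencing in `x`** ((5.4), PDF p. 22, the sums over `n ∼ x/2`): for `y ≤ x`,
`Δ_λ(x; d, a) − Δ_λ(y; d, a) = ∑_{y < n ≤ x, n ≡ a (d)} λ(n) − φ(d)⁻¹ ∑_{y < n ≤ x, (n,d)=1} λ(n)`,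
the range `y < n ≤ x` being `Ioc ⌊y⌋₊ ⌊x⌋₊`. [cite: FouvryTenenbaum2021, §5.1 (5.4)] -/
theorem liouvilleAPDelta_sub_of_le {x y : ℝ} (hyx : y ≤ x) (d : ℕ) (a : ℤ) :
    liouvilleAPDelta x d a - liouvilleAPDelta y d a =
      (∑ n ∈ (Ioc ⌊y⌋₊ ⌊x⌋₊).filter (fun n : ℕ => Int.ModEq d n a),
          (ArithmeticFunction.liouville n : ℝ)) -
        ((Nat.totient d : ℝ))⁻¹ *
          ∑ n ∈ (Ioc ⌊y⌋₊ ⌊x⌋₊).filter (fun n : ℕ => Nat.Coprime n d),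
            (ArithmeticFunction.liouville n : ℝ) := by
  have hfl : ⌊y⌋₊ ≤ ⌊x⌋₊ := Nat.floor_le_floor hyx
  have hsplit : ∀ (p : ℕ → Prop) [DecidablePred p],
      ∑ n ∈ (Icc 1 ⌊x⌋₊).filter p, (ArithmeticFunction.liouville n : ℝ) =
        ∑ n ∈ (Icc 1 ⌊y⌋₊).filter p, (ArithmeticFunction.liouville n : ℝ) +
          ∑ n ∈ (Ioc ⌊y⌋₊ ⌊x⌋₊).filter p, (ArithmeticFunction.liouville n : ℝ) := by
    intro p _
    have hI : ∀ m : ℕ, Icc 1 m = Ioc 0 m := fun m => by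
      ext n
      simp only [mem_Icc, mem_Ioc]
      omega
    rw [hI, hI, ← sum_union]
    · congr 1
      rw [← filter_union, Finset.Ioc_union_Ioc_eq_Ioc (Nat.zero_le _) hfl]
    · exact disjoint_filter_filter (Finset.Ioc_disjoint_Ioc_of_le le_rfl)
  unfold liouvilleAPDelta
  rw [hsplit, hsplit]
  ring

/-- **Dyadic decomposition in `x`** ((5.4), PDF p. 22: "we first perform a dyadic decomposition"):
if `x/2^J < 1` then `Δ_λ(x; d, a) = ∑_{j < J} (Δ_λ(x/2^j; d, a) − Δ_λ(x/2^{j+1}; d, a))`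
(telescoping down to an empty range). [cite: FouvryTenenbaum2021, §5.1 (5.4)] -/
theorem liouvilleAPDelta_eq_sum_dyadic {x : ℝ} {J : ℕ} (hJ : x / 2 ^ J < 1) (d : ℕ) (a : ℤ) :
    liouvilleAPDelta x d a =
      ∑ j ∈ range J, (liouvilleAPDelta (x / 2 ^ j) d a - liouvilleAPDelta (x / 2 ^ (j + 1)) d a) := by
  rw [Finset.sum_range_sub' (fun j => liouvilleAPDelta (x / 2 ^ j) d a), pow_zero, div_one,
    liouvilleAPDelta_of_lt_one hJ, sub_zero]

/-! ### Reduction to large `x` -/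

/-- **Reduction of Theorem 1.5 (for `λ`) to large `x` and `Q, R ≥ 1`** (§1.1, PDF p. 5: "In some
instances it will be implicitly assumed that `x` is sufficiently large").  If for every `A > 0`,
`ε > 0` there are `B, C, x₀` such that the bound (1.18) holds for all `x ≥ x₀`, `Q ≥ 1`, `R ≥ 1`
(and the printed side conditions), then `FouvryTenenbaum2021_thm15_liouville` holds, i.e. the bound
holds for all `x ≥ 1` with new constants: replace `B` by `max B 0` (a larger `B` only shrinks the
hypothesis `QR ≤ x ℒ^{−B}`, as `ℒ = log 3x > 1`) and `C` by `max C 0 + 2x₁ (log 3x₁)^A`,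
`x₁ = max x₀ 1`; for `1 ≤ x < x₀` the left side is `≤ ⌊R⌋⌊Q⌋·2x ≤ 2x²` because `⌊R⌋⌊Q⌋ ≤ QR ≤ x`,
and for `Q < 1` or `R < 1` it vanishes. [cite: FouvryTenenbaum2021, §1.1 and Theorem 1.5] -/
theorem FouvryTenenbaum2021_thm15_liouville.of_eventually
    (h : ∀ A : ℝ, 0 < A → ∀ ε : ℝ, 0 < ε → ∃ B C x₀ : ℝ, ∀ x : ℝ, x₀ ≤ x → ∀ Q R : ℝ,
      1 ≤ Q → 1 ≤ R → R ≤ x ^ (1 / 105 - ε) → Q * R ≤ x / Real.log (3 * x) ^ B →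
      ∀ a : ℤ, 1 ≤ |a| → (|a| : ℝ) ≤ Real.log (3 * x) ^ A →
        ∑ r ∈ (Icc 1 ⌊R⌋₊).filter (fun r : ℕ => IsCoprime (r : ℤ) a),
            |∑ q ∈ (Icc 1 ⌊Q⌋₊).filter (fun q : ℕ => IsCoprime (q : ℤ) a),
                liouvilleAPDelta x (q * r) a| ≤ C * x / Real.log (3 * x) ^ A) :
    FouvryTenenbaum2021_thm15_liouville := by
  intro A hA ε hε
  obtain ⟨B, C, x₀, hB⟩ := h A hA ε hε
  -- the constants
  set x₁ : ℝ := max x₀ 1 with hx₁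
  have hx₁1 : 1 ≤ x₁ := le_max_right _ _
  have hL₁ : 1 < Real.log (3 * x₁) := one_lt_log_three_mul hx₁1
  have hL₁pos : 0 < Real.log (3 * x₁) := by linarith
  set K : ℝ := 2 * x₁ * Real.log (3 * x₁) ^ A with hK
  have hK0 : 0 ≤ K := by
    have := Real.rpow_nonneg hL₁pos.le A
    positivity
  refine ⟨max B 0, max C 0 + K, fun x hx Q R hR hQR a ha haA => ?_⟩
  have hx0 : 0 < x := by linarith
  have hL : 1 < Real.log (3 * x) := one_lt_log_three_mul hx
  have hLpos : 0 < Real.log (3 * x) := by linarith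
  have hLA : 0 < Real.log (3 * x) ^ A := Real.rpow_pos_of_pos hLpos A
  -- the right side dominates both `K x ℒ^{-A}` and `C x ℒ^{-A}`, and is nonnegative
  have hRHS0 : 0 ≤ (max C 0 + K) * x / Real.log (3 * x) ^ A :=
    div_nonneg (mul_nonneg (add_nonneg (le_max_right _ _) hK0) hx0.le) hLA.le
  have hRHSK : K * x / Real.log (3 * x) ^ A ≤ (max C 0 + K) * x / Real.log (3 * x) ^ A := by
    refine div_le_div_of_nonneg_right ?_ hLA.le
    exact mul_le_mul_of_nonneg_right (by linarith [le_max_right C 0]) hx0.le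
  have hRHSC : C * x / Real.log (3 * x) ^ A ≤ (max C 0 + K) * x / Real.log (3 * x) ^ A := by
    refine div_le_div_of_nonneg_right ?_ hLA.le
    exact mul_le_mul_of_nonneg_right (by linarith [le_max_left C 0]) hx0.le
  -- empty ranges
  rcases lt_or_ge R 1 with hR1 | hR1
  · rw [FouvryTenenbaum2021_thm15_liouville_lhs_of_lt_one x Q R hR1 a]; exact hRHS0
  rcases lt_or_ge Q 1 with hQ1 | hQ1
  · rw [thm15_lhs_of_Q_lt_one x Q R hQ1 a]; exact hRHS0
  -- the level hypothesis with `B` in place of `max B 0`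
  have hQR' : Q * R ≤ x / Real.log (3 * x) ^ B :=
    hQR.trans (div_le_div_of_nonneg_left hx0.le (Real.rpow_pos_of_pos hLpos B)
      (Real.rpow_le_rpow_of_exponent_le hL.le (le_max_left B 0)))
  rcases le_or_gt x₀ x with hx₀ | hx₀
  · -- large `x`: the hypothesis
    exact (hB x hx₀ Q R hQ1 hR1 hR hQR' a ha haA).trans hRHSC
  · -- small `x`: `1 ≤ x < x₀ ≤ x₁`, trivial bound `≤ 2x² ≤ K x ℒ^{-A}`
    have hxx₁ : x ≤ x₁ := hx₀.le.trans (le_max_left _ _)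
    have hfl : (⌊R⌋₊ : ℝ) * ⌊Q⌋₊ ≤ x := by
      calc (⌊R⌋₊ : ℝ) * ⌊Q⌋₊ ≤ R * Q :=
            mul_le_mul (Nat.floor_le (by linarith)) (Nat.floor_le (by linarith))
              (Nat.cast_nonneg _) (by linarith)
        _ = Q * R := mul_comm _ _
        _ ≤ x / Real.log (3 * x) ^ max B 0 := hQR
        _ ≤ x := div_le_self hx0.le (Real.one_le_rpow hL.le (le_max_right B 0))
    have h1 : ∑ r ∈ (Icc 1 ⌊R⌋₊).filter (fun r : ℕ => IsCoprime (r : ℤ) a),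
        |∑ q ∈ (Icc 1 ⌊Q⌋₊).filter (fun q : ℕ => IsCoprime (q : ℤ) a),
            liouvilleAPDelta x (q * r) a| ≤ 2 * x ^ 2 := by
      calc _ ≤ ⌊R⌋₊ * (⌊Q⌋₊ * (2 * x)) := thm15_lhs_le hx0.le Q R a
        _ = (⌊R⌋₊ * ⌊Q⌋₊) * (2 * x) := by ring
        _ ≤ x * (2 * x) := mul_le_mul_of_nonneg_right hfl (by positivity)
        _ = 2 * x ^ 2 := by ring
    have hLx₁ : Real.log (3 * x) ^ A ≤ Real.log (3 * x₁) ^ A :=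
      Real.rpow_le_rpow hLpos.le (Real.log_le_log (by positivity) (by linarith)) hA.le
    have h2 : 2 * x ^ 2 ≤ K * x / Real.log (3 * x) ^ A := by
      rw [le_div_iff₀ hLA]
      calc 2 * x ^ 2 * Real.log (3 * x) ^ A ≤ 2 * x ^ 2 * Real.log (3 * x₁) ^ A :=
            mul_le_mul_of_nonneg_left hLx₁ (by positivity)
        _ ≤ 2 * (x₁ * x) * Real.log (3 * x₁) ^ A := by
            refine mul_le_mul_of_nonneg_right ?_ (Real.rpow_nonneg hL₁pos.le A)
            nlinarith
        _ = K * x := by rw [hK]; ring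
    linarith

/-! ### The signed form (§5.1, (5.4)–(5.5)) -/

/-- **Theorem 1.5 (for `λ`) from its signed form** (§5.1, (5.4)–(5.5), PDF p. 22: the outer absolute
values are traded for weights "`ξ_r` … satisfying `|ξ_r| ≤ 1`", after which the double sum is
regrouped along `s = qr`).  If for every `A > 0`, `ε > 0` there are `B, C, x₀` such that for
`x ≥ x₀`, `Q, R ≥ 1`, `R ≤ x^{1/105−ε}`, `QR ≤ x ℒ^{−B}`, `1 ≤ |a| ≤ ℒ^A` and EVERY real weight
`|ξ_r| ≤ 1` one has `∑_{r ≤ R, (r,a)=1} ξ_r ∑_{q ≤ Q, (q,a)=1} Δ_λ(x; qr, a) ≤ C x ℒ^{−A}`, then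
`FouvryTenenbaum2021_thm15_liouville` holds (take `ξ_r = sgn ∑_q Δ_λ(x; qr, a)` and
`FouvryTenenbaum2021_thm15_liouville.of_eventually`). [cite: FouvryTenenbaum2021, §5.1 (5.4)–(5.5)] -/
theorem FouvryTenenbaum2021_thm15_liouville.of_signed
    (h : ∀ A : ℝ, 0 < A → ∀ ε : ℝ, 0 < ε → ∃ B C x₀ : ℝ, ∀ x : ℝ, x₀ ≤ x → ∀ Q R : ℝ,
      1 ≤ Q → 1 ≤ R → R ≤ x ^ (1 / 105 - ε) → Q * R ≤ x / Real.log (3 * x) ^ B →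
      ∀ a : ℤ, 1 ≤ |a| → (|a| : ℝ) ≤ Real.log (3 * x) ^ A → ∀ ξ : ℕ → ℝ, (∀ r, |ξ r| ≤ 1) →
        ∑ r ∈ (Icc 1 ⌊R⌋₊).filter (fun r : ℕ => IsCoprime (r : ℤ) a),
            ξ r * ∑ q ∈ (Icc 1 ⌊Q⌋₊).filter (fun q : ℕ => IsCoprime (q : ℤ) a),
                liouvilleAPDelta x (q * r) a ≤ C * x / Real.log (3 * x) ^ A) :
    FouvryTenenbaum2021_thm15_liouville := by
  refine FouvryTenenbaum2021_thm15_liouville.of_eventually fun A hA ε hε => ?_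
  obtain ⟨B, C, x₀, hB⟩ := h A hA ε hε
  refine ⟨B, C, x₀, fun x hx Q R hQ hR hRx hQR a ha haA => ?_⟩
  -- the inner sums and their signs
  set S : ℕ → ℝ := fun r => ∑ q ∈ (Icc 1 ⌊Q⌋₊).filter (fun q : ℕ => IsCoprime (q : ℤ) a),
    liouvilleAPDelta x (q * r) a with hS
  set ξ : ℕ → ℝ := fun r => if 0 ≤ S r then 1 else -1 with hξ
  have hξ1 : ∀ r, |ξ r| ≤ 1 := fun r => by
    simp only [hξ]; split_ifs <;> simp
  have hξS : ∀ r, ξ r * S r = |S r| := fun r => by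
    simp only [hξ]
    split_ifs with h0
    · rw [one_mul, abs_of_nonneg h0]
    · rw [abs_of_neg (not_le.mp h0)]; ring
  have key := hB x hx Q R hQ hR hRx hQR a ha haA ξ hξ1
  calc ∑ r ∈ (Icc 1 ⌊R⌋₊).filter (fun r : ℕ => IsCoprime (r : ℤ) a), |S r|
        = ∑ r ∈ (Icc 1 ⌊R⌋₊).filter (fun r : ℕ => IsCoprime (r : ℤ) a), ξ r * S r :=
          sum_congr rfl fun r _ => (hξS r).symm
    _ ≤ C * x / Real.log (3 * x) ^ A := key

/-- **The signed form from Theorem 1.5 (for `λ`)**: under `FouvryTenenbaum2021_thm15_liouville`, for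
`A > 0`, `ε > 0` there are `B, C` such that for `x ≥ 1`, `R ≤ x^{1/105−ε}`, `QR ≤ x ℒ^{−B}`,
`1 ≤ |a| ≤ ℒ^A` and every real `|ξ_r| ≤ 1`,
`|∑_{r ≤ R, (r,a)=1} ξ_r ∑_{q ≤ Q, (q,a)=1} Δ_λ(x; qr, a)| ≤ C x ℒ^{−A}` (`|∑ ξ_r S_r| ≤ ∑ |S_r|`).
[cite: FouvryTenenbaum2021, §5.1 (5.4)–(5.5)] -/
theorem FouvryTenenbaum2021_thm15_liouville.signed_le (h : FouvryTenenbaum2021_thm15_liouville)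
    {A : ℝ} (hA : 0 < A) {ε : ℝ} (hε : 0 < ε) :
    ∃ B C : ℝ, ∀ x : ℝ, 1 ≤ x → ∀ Q R : ℝ,
      R ≤ x ^ (1 / 105 - ε) → Q * R ≤ x / Real.log (3 * x) ^ B →
      ∀ a : ℤ, 1 ≤ |a| → (|a| : ℝ) ≤ Real.log (3 * x) ^ A → ∀ ξ : ℕ → ℝ, (∀ r, |ξ r| ≤ 1) →
        |∑ r ∈ (Icc 1 ⌊R⌋₊).filter (fun r : ℕ => IsCoprime (r : ℤ) a),
            ξ r * ∑ q ∈ (Icc 1 ⌊Q⌋₊).filter (fun q : ℕ => IsCoprime (q : ℤ) a),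
                liouvilleAPDelta x (q * r) a| ≤ C * x / Real.log (3 * x) ^ A := by
  obtain ⟨B, C, hB⟩ := h A hA ε hε
  refine ⟨B, C, fun x hx Q R hR hQR a ha haA ξ hξ => ?_⟩
  refine (abs_sum_le_sum_abs _ _).trans ((sum_le_sum fun r _ => ?_).trans
    (hB x hx Q R hR hQR a ha haA))
  rw [abs_mul]
  exact (mul_le_mul_of_nonneg_right (hξ r) (abs_nonneg _)).trans (by rw [one_mul])

end Literature.NumberTheory.Sieve

end
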